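import Summits.QuantumFields.YangMills.Theorems.BalabanLadderIROddTorusLargeFieldRarity
import Summits.QuantumFields.YangMills.Theorems.LangevinControlUVFemtoCurvatureTwoPointStubDoublingOfRV
import HarnessLib

/-!
# Hereditary large-field rarity on the ODD four-tori for every faithful unitary lattice representation, with a
# VOLUME-FREE base

Support file (seat ym-infvol-p3, fleet R136 (i); bears on crux `IR` = stmt-QuantumFields-19354, registered line
«af-pincer-T» clause (iii_T) of `TypShellCond` («torus anchor») / line «hamming» clause (ii); count-neutral helper).

The (iii_T) clause quantifies its rarity budget `δ` BEFORE the torus side `2S+1`, so the base of the hereditary bound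
`measureReal_forall_le_cellAction_le_pow` (`…OddTorusLargeFieldRarity`),
`m · exp(-λT/m² + n Δ_L(λ)/(m L⁴))`, must be bounded uniformly in `L`.  For every compact `G` with a lattice
representation `r : LatticeRep G` (faithful, continuous, unitary) in `d = 4` this holds:

* `torusLogPartition_sub_le_rep` — `Δ_L(λ) = log Z_L(β-λ) - log Z_L(β) ≤ L⁴ · (48 - 4 log C₁ + 2 D log β)` for `β ≥ 1`,
  `0 ≤ λ ≤ β`, with `D = dimE r.ρ` and the constant `C₁` of the tree's Gaussian-scale link-ball bound
  `FemtoCurvatureTwoPoint.DoublingOfRV.partitionFunction_toReal_ge_inv_sqrt_pow` (lower bound) and the non-negativity of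
  the Wilson action of a unitary representation (upper bound `log Z_L ≤ 0`);
* `measureReal_forall_le_cellAction_le_pow_rep` — hence `∃ K₀ D, ∀ L odd ≥ 3, β ≥ 1, 0 ≤ λ ≤ β`, disjoint cells with
  `≤ n` plaquettes each, any `T`:
  `μ^{r}_{L,β}{∀ i ∈ F, T ≤ ∑_{q∈P_i} φ_q} ≤ (m · exp(-λT/m² + n (K₀ + D log β)/m)) ^ #F`, base independent of `L`.

HONEST FRAMING: finite-torus Peierls–chessboard rarity for the bare Wilson action; nothing about decoupling, typical-data
mixing (clause (i_T)), the mass gap, or infinite volume.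
-/

noncomputable section

open MeasureTheory Finset
open Literature.MathematicalPhysics
open Literature.MathematicalPhysics.QuantumFieldTheory Literature.MathematicalPhysics.QuantumLattice
open Summit.QuantumFields.YangMills.Theorems.FreeEnergyLogCoefficient

namespace Summit.QuantumFields.YangMills.Theorems.OddTorusChessboard

variable {G : Type} [Group G] [TopologicalSpace G] [IsTopologicalGroup G] [CompactSpace G]
  [MeasurableSpace G] [BorelSpace G]

/-- `log Z_L(β) ≤ 0` for `β ≥ 0` and a lattice representation (the Wilson action of a unitary representation is
non-negative and product Haar measure is a probability measure). -/
theorem torusLogPartition_nonpos_rep (r : LatticeRep G) {L : ℕ} [NeZero L] {β : ℝ} (hβ : 0 ≤ β) :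
    torusLogPartition 4 r.ρ β L ≤ 0 := by
  have hρc : Continuous r.ρ := r.continuous
  have hρN : ∀ g : G, (r.ρ g).trace.re ≤ r.N := fun g => by
    have h := Literature.RepresentationTheory.CompactGroups.CompactGroup.abs_re_trace_le_card r.ρ hρc g
    simp only [Fintype.card_fin] at h
    exact (le_abs_self _).trans h
  set π₀ : Measure (GaugeConfig 4 L G) := Measure.pi fun _ : Edge 4 L => haarProbability G with hπ₀
  rw [torusLogPartition_eq_log_integral r.ρ hρc β]
  have hle : ∫ U, Real.exp (-β * wilsonAction r.ρ U) ∂π₀ ≤ 1 := by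
    calc ∫ U, Real.exp (-β * wilsonAction r.ρ U) ∂π₀ ≤ ∫ _U, (1 : ℝ) ∂π₀ := by
          refine integral_mono (integrable_exp_mul_wilsonAction r.ρ hρc (-β) π₀) (integrable_const _) fun U => ?_
          have hS : 0 ≤ wilsonAction r.ρ U := wilsonAction_nonneg_of_re_trace_le r.ρ hρN U
          show Real.exp (-β * wilsonAction r.ρ U) ≤ 1
          rw [Real.exp_le_one_iff]
          nlinarith
      _ = 1 := by rw [integral_const, probReal_univ, one_smul]
  exact Real.log_nonpos (integral_exp_neg_mul_wilsonAction_pos r.ρ hρc β).le hle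

/-- **Crude Gaussian lower bound for `log Z_L(β)`**, uniformly in `L`, for a lattice representation:
`-48 L⁴ + 4 L⁴ (log C₁ - (D/2) log β) ≤ log Z_L(β)`, `β ≥ 1`, `D = dimE r.ρ`. -/
theorem torusLogPartition_lower_rep (r : LatticeRep G) :
    ∃ C₁ : ℝ, 0 < C₁ ∧ ∀ (L : ℕ) [NeZero L] (β : ℝ), 1 ≤ β →
      -(48 * (L : ℝ) ^ 4) + 4 * (L : ℝ) ^ 4 * (Real.log C₁ - (dimE r.ρ : ℝ) / 2 * Real.log β) ≤
        torusLogPartition 4 r.ρ β L := by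
  obtain ⟨C₁, hC₁, h⟩ := FemtoCurvatureTwoPoint.DoublingOfRV.partitionFunction_toReal_ge_inv_sqrt_pow r
  refine ⟨C₁, hC₁, fun L _ β hβ => ?_⟩
  set D : ℕ := dimE r.ρ with hD
  have hβ0 : 0 < β := by linarith
  have hs0 : 0 < Real.sqrt β := Real.sqrt_pos.2 hβ0
  have hmain := h L β hβ
  have hpos : 0 < Real.exp (-(48 * (L : ℝ) ^ 4)) * (C₁ * (Real.sqrt β)⁻¹ ^ D) ^ (4 * L ^ 4) := by positivity
  have hlog := Real.log_le_log hpos hmain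
  have hx : 0 < C₁ * (Real.sqrt β)⁻¹ ^ D := by positivity
  rw [Real.log_mul (Real.exp_pos _).ne' (pow_pos hx _).ne', Real.log_exp, Real.log_pow,
    Real.log_mul hC₁.ne' (pow_pos (inv_pos.2 hs0) _).ne', Real.log_pow, Real.log_inv,
    Real.log_sqrt hβ0.le] at hlog
  have e : -(48 * (L : ℝ) ^ 4) + ((4 * L ^ 4 : ℕ) : ℝ) * (Real.log C₁ + (D : ℝ) * -(Real.log β / 2)) =
      -(48 * (L : ℝ) ^ 4) + 4 * (L : ℝ) ^ 4 * (Real.log C₁ - (D : ℝ) / 2 * Real.log β) := by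
    push_cast; ring
  rw [e] at hlog
  exact hlog

/-- **The free-energy difference is volume-free**: `log Z_L(β-λ) - log Z_L(β) ≤ L⁴ (48 - 4 log C₁ + 2D log β)` for
`β ≥ 1`, `0 ≤ λ ≤ β`. -/
theorem torusLogPartition_sub_le_rep (r : LatticeRep G) :
    ∃ C₁ : ℝ, 0 < C₁ ∧ ∀ (L : ℕ) [NeZero L] (β lam : ℝ), 1 ≤ β → 0 ≤ lam → lam ≤ β →
      torusLogPartition 4 r.ρ (β - lam) L - torusLogPartition 4 r.ρ β L ≤
        (L : ℝ) ^ 4 * (48 - 4 * Real.log C₁ + 2 * (dimE r.ρ : ℝ) * Real.log β) := by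
  obtain ⟨C₁, hC₁, hlow⟩ := torusLogPartition_lower_rep r
  refine ⟨C₁, hC₁, fun L _ β lam hβ hlam hlamβ => ?_⟩
  have h1 : torusLogPartition 4 r.ρ (β - lam) L ≤ 0 := torusLogPartition_nonpos_rep r (by linarith)
  have h2 := hlow L β hβ
  nlinarith

/-- **Hereditary large-field rarity on odd four-tori, volume-free base, every lattice representation.**  For
`r : LatticeRep G`: `∃ K₀ D, ∀ L odd ≥ 3, β ≥ 1, 0 ≤ λ ≤ β`, pairwise disjoint cells with at most `n` plaquettes each
and every `T`,  `μ_{L,β}{∀ i ∈ F, T ≤ ∑_{q∈P_i} φ_q} ≤ (m · exp(-λT/m² + n (K₀ + D log β)/m)) ^ #F`. -/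
theorem measureReal_forall_le_cellAction_le_pow_rep (r : LatticeRep G) :
    ∃ K₀ : ℝ, ∃ D : ℕ, ∀ {L : ℕ} [NeZero L], Odd L → 3 ≤ L → ∀ (β : ℝ), 1 ≤ β → ∀ (lam : ℝ), 0 ≤ lam → lam ≤ β →
      ∀ {ι : Type} (F : Finset ι) (P : ι → Finset (Plaquette 4 L)),
        (∀ i ∈ F, ∀ j ∈ F, i ≠ j → Disjoint (P i) (P j)) → ∀ (n : ℕ), (∀ i ∈ F, #(P i) ≤ n) → ∀ T : ℝ,
          (wilsonMeasure (d := 4) (L := L) r.ρ β).real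
              {U : GaugeConfig 4 L G | ∀ i ∈ F, T ≤ ∑ q ∈ P i, plaquetteCost r.ρ U q} ≤
            ((Fintype.card (Orient 4) : ℝ) *
              Real.exp (-(lam * T) / (Fintype.card (Orient 4) : ℝ) ^ 2 +
                n * (K₀ + D * Real.log β) / Fintype.card (Orient 4))) ^ #F := by
  obtain ⟨C₁, hC₁, hΔ⟩ := torusLogPartition_sub_le_rep r
  refine ⟨48 - 4 * Real.log C₁, 2 * dimE r.ρ, ?_⟩
  intro L _ hL hL3 β hβ lam hlam hlamβ ι F P hdisj n hn T
  have hρc : Continuous r.ρ := r.continuous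
  set m : ℕ := Fintype.card (Orient 4) with hmdef
  have hm : 0 < Fintype.card (Orient 4) := Fintype.card_pos_iff.2 ⟨⟨((0 : Fin 4), (1 : Fin 4)), by decide⟩⟩
  have hm0 : (0 : ℝ) < m := by exact_mod_cast hm
  have h := measureReal_forall_le_cellAction_le_pow (d := 4) (L := L) r.ρ hL hL3 hρc hlam hlamβ F P hdisj hn T hm
  refine h.trans (pow_le_pow_left₀ (by positivity) ?_ _)
  refine mul_le_mul_of_nonneg_left (Real.exp_le_exp.2 ?_) hm0.le
  have hL0 : (0 : ℝ) < (L : ℝ) ^ 4 := by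
    have : (0 : ℝ) < L := by exact_mod_cast (show 0 < L by omega)
    positivity
  have hdiv : (torusLogPartition 4 r.ρ (β - lam) L - torusLogPartition 4 r.ρ β L) / (L : ℝ) ^ 4 ≤
      48 - 4 * Real.log C₁ + ((2 * dimE r.ρ : ℕ) : ℝ) * Real.log β := by
    rw [div_le_iff₀ hL0]
    have := hΔ L β lam hβ hlam hlamβ
    push_cast
    linarith
  have hn0 : (0 : ℝ) ≤ n := Nat.cast_nonneg _
  have := mul_le_mul_of_nonneg_left hdiv hn0
  refine add_le_add le_rfl ?_
  exact div_le_div_of_nonneg_right this hm0.le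

end Summit.QuantumFields.YangMills.Theorems.OddTorusChessboard

end
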